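import Summits.ResolutionOfSingularities.ResolutionOfSingularities.Theorems.RadicialJungCleanModelsT2BlowupStalkChart
import Summits.ResolutionOfSingularities.ResolutionOfSingularities.Theorems.RadicialJungCleanModelsLogDerivationsChart
import HarnessLib

/-!
# Route `RadicialJung`, crux `CleanModels` (stmt-15917): the image `T ≤ K(X)` of a local ring of
# the point blow-up is stable under the derivations of `K(X)` preserving `R` and the chart
# generator (T2 brick B5-a, part 5: the hypothesis `hT` of the chart dictionary)

Support file (OURS) for PROGRAMME-clean-dim2 / T2, companion of
`RadicialJungCleanModelsT2BlowupStalkChart.lean`. Nothing here is a statement of Hironaka's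
manuscript. The chart dictionary (C1)/(C2) of res-L0-w81-pv-2
(`RadicialJungCleanModelsLogContentIdealBlowup.lean`) and res-L0-w81-pv-1's `…GiraudStepPoint*`
take the hypothesis

  `hT : ∀ D : Derivation ℤ K K, (∀ r : R, D r ∈ R) → D (v/u) ∈ T → ∀ t : T, D t ∈ T`

for the local ring `T` of the blow-up inside `K`. For `T = im ε_{ξ₁} = R[v/u]_Q` (part 1,
`range_stalkEmb_eq_ofPrime_chartAdjoin`) this is the quotient rule: `D` maps `R[v/u]` into `T`
(Leibniz on monomials in `v/u`), and `D(a/s) = (s·Da − a·Ds)/s²` with `1/s ∈ T` for `s ∉ Q`.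

* `derivation_mapsTo_of_adjoin_le` — `D(R) ⊆ R ≤ T`, `z ∈ T`, `D z ∈ T` ⇒ `D(R[z]) ⊆ T`;
* `derivation_mapsTo_range_stalkEmb` — **`hT` for `T = im ε_{ξ₁}`** in the `u`-chart.
-/

noncomputable section

set_option linter.dupNamespace false -- mandated namespace of this single-conjunct summit

open CategoryTheory AlgebraicGeometry TopologicalSpace IsLocalRing
open Literature.AlgebraicGeometry.Resolution

namespace Summit.ResolutionOfSingularities.ResolutionOfSingularities.Theorems.RadicialJung.CleanModels.T2

universe u

open Scheme.IdealSheafData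

/-- **Leibniz on `R[z]` with values in a bigger subring**: if `D(R) ⊆ R ≤ T`, `z ∈ T` and
`D z ∈ T`, then `D` maps `R[z]` into `T`. [folklore] -/
theorem derivation_mapsTo_of_adjoin_le {K : Type u} [Field K] {R T : Subring K} (hRT : R ≤ T)
    (D : Derivation ℤ K K) (hD : ∀ r : R, D r ∈ R) {z : K} (hz : z ∈ T) (hDz : D z ∈ T) :
    ∀ w ∈ Algebra.adjoin R {z}, D w ∈ T := by
  let TA : Subalgebra R K :=
    { carrier := T
      mul_mem' := T.mul_mem
      one_mem' := T.one_mem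
      add_mem' := T.add_mem
      zero_mem' := T.zero_mem
      algebraMap_mem' := fun r => hRT r.2 }
  have hAT : ∀ {a : K}, a ∈ Algebra.adjoin R {z} → a ∈ T := fun ha =>
    (Algebra.adjoin_le (S := TA) (Set.singleton_subset_iff.mpr hz)) ha
  intro w hw
  induction hw using Algebra.adjoin_induction with
  | mem t ht =>
    rw [Set.mem_singleton_iff] at ht
    subst ht
    exact hDz
  | algebraMap r => exact hRT (hD r)
  | add a b _ _ ha hb => rw [map_add]; exact add_mem ha hb
  | mul a b ha' hb' ha hb =>
    rw [Derivation.leibniz, smul_eq_mul, smul_eq_mul]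
    exact add_mem (T.mul_mem (hAT ha') hb) (T.mul_mem (hAT hb') ha)

variable {X₁ X : Scheme.{u}} [IsIntegral X] [IsLocallyNoetherian X] {π : X₁ ⟶ X}
  {J : X.IdealSheafData}

/-- **`T = im ε_{ξ₁}` is stable under every derivation of `K(X)` preserving `R` and `v/u`**
(`u`-chart, `u ≠ 0`): the hypothesis `hT` of the chart dictionary (C1)/(C2) and of
`giraudColength_lt_of_chart` / `giraud23_trichotomy_of_oppositeChart_origin`.
[cite: StacksProject, Tag 07PE] -/
theorem derivation_mapsTo_range_stalkEmb (hπ : IsBlowup π J) (x' : X₁)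
    (hJ : stalkIdeal J (π x') = maximalIdeal (X.presheaf.stalk (π x')))
    (u v : X.presheaf.stalk (π x')) (huv : maximalIdeal (X.presheaf.stalk (π x')) = Ideal.span {u, v})
    (hu0 : u ≠ 0)
    (hle : haveI := isLocalRing_range_algebraMap_stalk (X := X) (π x')
      chartAdjoin (K := X.functionField)
        (⟨algebraMap _ X.functionField u, u, rfl⟩ :
          (algebraMap (X.presheaf.stalk (π x')) X.functionField).range)
        ⟨algebraMap _ X.functionField v, v, rfl⟩ ≤ (hπ.stalkEmb x').range)
    (D : Derivation ℤ X.functionField X.functionField)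
    (hD : ∀ r : (algebraMap (X.presheaf.stalk (π x')) X.functionField).range,
      D r ∈ (algebraMap (X.presheaf.stalk (π x')) X.functionField).range)
    (hDv : D (algebraMap _ X.functionField v / algebraMap _ X.functionField u) ∈
      (hπ.stalkEmb x').range) :
    ∀ t : (hπ.stalkEmb x').range, D t ∈ (hπ.stalkEmb x').range := by
  haveI := isLocalRing_range_algebraMap_stalk (X := X) (π x')
  haveI := isLocalRing_range_stalkEmb hπ x'
  have hTeq := range_stalkEmb_eq_ofPrime_chartAdjoin hπ x' hJ u v huv hu0 hle
  have hRT := range_algebraMap_le_range_stalkEmb hπ x'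
  -- `D` maps the chart `R[v/u]` into `T`
  have hvu : algebraMap _ X.functionField v / algebraMap _ X.functionField u ∈
      (hπ.stalkEmb x').range :=
    hle (Algebra.subset_adjoin (Set.mem_singleton _))
  have hA := derivation_mapsTo_of_adjoin_le hRT D hD hvu hDv
  -- an element of `T = R[v/u]_Q` is `a/s` with `s ∉ Q`, a unit of `T`
  intro t
  have ht : (t : X.functionField) ∈ (LocalSubring.ofPrime _
      ((maximalIdeal (hπ.stalkEmb x').range).comap (Subring.inclusion hle))).toSubring := by
    rw [← hTeq]; exact t.2
  obtain ⟨a, s, hs, hts⟩ := mem_ofPrime_iff.mp ht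
  have hs0 : ((s : chartAdjoin (K := X.functionField)
      (⟨algebraMap _ X.functionField u, u, rfl⟩ :
        (algebraMap (X.presheaf.stalk (π x')) X.functionField).range)
      ⟨algebraMap _ X.functionField v, v, rfl⟩) : X.functionField) ≠ 0 :=
    coe_ne_zero_of_not_mem hs
  have hsinv : ((s : _) : X.functionField)⁻¹ ∈ (hπ.stalkEmb x').range := by
    have h := inv_mem_ofPrime (K := X.functionField) hs
    rwa [← hTeq] at h
  rw [hts, derivation_apply_div_eq D _ _ hs0, div_eq_mul_inv, pow_two, mul_inv]
  refine Subring.mul_mem _ (Subring.sub_mem _ (Subring.mul_mem _ (hle s.2) (hA _ a.2))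
    (Subring.mul_mem _ (hle a.2) (hA _ s.2))) (Subring.mul_mem _ hsinv hsinv)

end Summit.ResolutionOfSingularities.ResolutionOfSingularities.Theorems.RadicialJung.CleanModels.T2

end
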